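import Summits.ValiantsHypothesis.ValiantsHypothesis.Theorems.BarrierLeverChowHitsThinRowPartitionMinorsRLabelsPrelims
import Summits.ValiantsHypothesis.ValiantsHypothesis.Theorems.BarrierLeverChowHitsThinRowPartitionMinorsRGadget
import Summits.ValiantsHypothesis.ValiantsHypothesis.Theorems.BarrierLeverChowThinRowsLabelledPairsPrelims

/-!
# Route BarrierLever — item `ChowHitsThinRowPartitionMinorsR` (stmt-ValiantsHypothesis-21850, budget
# `h·h`): reduction to the LEAVE-OUT MATRIX of an arbitrary `y`-design

Helper file (`--supports stmt-ValiantsHypothesis-21850`; cell valiant-natproofs, rung V4, 𝒟-side;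
seat val-np-p5 gen 28).  Closes NO item; definition-free; imports this seat's `…RGadget`,
`…RLabelsPrelims` and val-np-p8's `…ChowThinRowsLabelledPairsPrelims` (`ChowSubcube.yOnly_prod`).

**Theorem `chowHitsHH_of_leaveOut`** (the typed form of the cell's Conjecture LO / AC).  Thin layout
`(u, w)`, `u` injective.  Give every singleton row `u i = {a}` ONE affine form `1 + x_a + β_i(y)` with an
ARBITRARY `y`-part, every pair row `u i = {a,b}` the antipodal gadget `(1 + β_i(y)) ± λ(x_a + x_b)`,
and add `np` public `y`-forms `1 + π_p(y)`, with `#singleton rows + np + 2·#pair rows ≤ h·h`.  If the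
LEAVE-OUT MATRIX
`M̂[i, j] = coeff_{y^{w j}} ( ∏_{i' singleton, i' ≠ i} (1 + β_{i'}) · ∏_p (1 + π_p) · ∏_{i' pair, i' ≠ i} (1 + β_{i'})² )`
is nonsingular, then the layout is hit by `h·h` affine forms (item 21850's conclusion for `(u, w)`).
The matrix depends on the rows only through their sizes `|u i| ∈ {0,1,2}`; the labelled certificates of
`…RLabels`, `…RLabelsUsed` and the ABSORBED certificate of memo MEMO-21850-hh-valnp5-g28 §7 (excess
singleton rows carry a defect coordinate in `β_i`) are all instances.  Mechanism: the `x`-dedicated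
singleton forms give `coeff (E {a} W) = ` leave-one-out (`coeff_single_prod_forms`, any index type),
the `x`-parts never touch `∅`-rows (`coeff_empty_prod_forms`), and `chowHitsHH_of_gadgetCertificate`.

WHAT THIS IS NOT: item 21850 is NOT proved (the nonsingularity of `M̂` for a suitable design on the
residual layouts — Conjecture AC — is open); nothing on items 21882 / 19717, on crux
stmt-ValiantsHypothesis-14610, or on `VP` versus `VNP`.
-/

set_option linter.dupNamespace false

namespace Summit.ValiantsHypothesis.ValiantsHypothesis.Theorems.BarrierLever.ChowThinHH

open Finset MvPolynomial
open Summit.ValiantsHypothesis.ValiantsHypothesis.Theorems.BarrierLever.ChowFactor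
  (coeff_partitionExpo_mul_affine coeff_partitionExpo_mul_affineY coeff_partitionExpo_mul_yOnly
    totalDegree_affine_le)
open Summit.ValiantsHypothesis.ValiantsHypothesis.Theorems.BarrierLever.CorankRepair (partitionExpo_eq_iff)

variable {h r : ℕ}

/-! ## 1. Rows `∅` and `{a}` of a product of affine forms over ANY index type -/

/-- One `y`-only affine factor in the `C 1 + …` notation:
`coeff (E u w) (f · (C 1 + Σ_c C (b c) y_c)) = coeff (E u w) f + Σ_{c ∈ w} b c · coeff (E u (w.erase c)) f`. -/
theorem coeff_mul_yform (f : MvPolynomial (Fin (h + h)) ℂ) (b : Fin h → ℂ) (u w : Finset (Fin h)) :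
    coeff (∑ a ∈ u, Finsupp.single (Fin.castAdd h a) 1 + ∑ c ∈ w, Finsupp.single (Fin.natAdd h c) 1)
        (f * (C 1 + ∑ c, C (b c) * X (Fin.natAdd h c))) =
      coeff (∑ a ∈ u, Finsupp.single (Fin.castAdd h a) 1 +
          ∑ c ∈ w, Finsupp.single (Fin.natAdd h c) 1) f +
        ∑ c ∈ w, b c * coeff (∑ a ∈ u, Finsupp.single (Fin.castAdd h a) 1 +
          ∑ c' ∈ w.erase c, Finsupp.single (Fin.natAdd h c') 1) f := by
  rw [C_1]
  exact coeff_partitionExpo_mul_affineY f b u w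


/-- **Row `∅`**: the `x`-parts do not affect the `x`-free partition coefficients. -/
theorem coeff_empty_prod_forms {ι : Type*} [DecidableEq ι] (K : Finset ι) (A B : ι → Fin h → ℂ)
    (W : Finset (Fin h)) :
    coeff (∑ a ∈ (∅ : Finset (Fin h)), Finsupp.single (Fin.castAdd h a) 1 +
        ∑ c ∈ W, Finsupp.single (Fin.natAdd h c) 1)
        (∏ k ∈ K, ((C 1 + ∑ a, C (A k a) * X (Fin.castAdd h a) + ∑ c, C (B k c) * X (Fin.natAdd h c)) :
          MvPolynomial (Fin (h + h)) ℂ)) =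
      coeff (∑ a ∈ (∅ : Finset (Fin h)), Finsupp.single (Fin.castAdd h a) 1 +
        ∑ c ∈ W, Finsupp.single (Fin.natAdd h c) 1)
        (∏ k ∈ K, ((C 1 + ∑ c, C (B k c) * X (Fin.natAdd h c)) : MvPolynomial (Fin (h + h)) ℂ)) := by
  classical
  induction K using Finset.induction_on generalizing W with
  | empty => simp
  | insert k₀ K hk₀ ih =>
    rw [Finset.prod_insert hk₀, Finset.prod_insert hk₀, mul_comm, coeff_partitionExpo_mul_affine]
    have h0 : (∑ a ∈ (∅ : Finset (Fin h)), A k₀ a *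
        coeff (∑ a' ∈ (∅ : Finset (Fin h)).erase a, Finsupp.single (Fin.castAdd h a') 1 +
          ∑ c ∈ W, Finsupp.single (Fin.natAdd h c) 1)
          (∏ k ∈ K, ((C 1 + ∑ a, C (A k a) * X (Fin.castAdd h a) + ∑ c, C (B k c) * X (Fin.natAdd h c)) :
            MvPolynomial (Fin (h + h)) ℂ))) = 0 := Finset.sum_empty
    rw [h0, add_zero, one_mul, mul_comm (C 1 + ∑ c, C (B k₀ c) * X (Fin.natAdd h c)), coeff_mul_yform, ih W]
    exact congrArg _ (Finset.sum_congr rfl fun c _ => by rw [ih (W.erase c)])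

/-- **Row `{a}`**: `coeff (E {a} W) ∏_{k∈K} ℓ_k = Σ_{k ∈ K} A k a · coeff (E ∅ W) (∏_{K.erase k} λ_k)` where
`λ_k` are the `y`-parts. -/
theorem coeff_single_prod_forms {ι : Type*} [DecidableEq ι] (K : Finset ι) (A B : ι → Fin h → ℂ)
    (a : Fin h) (W : Finset (Fin h)) :
    coeff (∑ a' ∈ ({a} : Finset (Fin h)), Finsupp.single (Fin.castAdd h a') 1 +
        ∑ c ∈ W, Finsupp.single (Fin.natAdd h c) 1)
        (∏ k ∈ K, ((C 1 + ∑ a, C (A k a) * X (Fin.castAdd h a) + ∑ c, C (B k c) * X (Fin.natAdd h c)) :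
          MvPolynomial (Fin (h + h)) ℂ)) =
      ∑ k ∈ K, A k a * coeff (∑ a ∈ (∅ : Finset (Fin h)), Finsupp.single (Fin.castAdd h a) 1 +
        ∑ c ∈ W, Finsupp.single (Fin.natAdd h c) 1)
        (∏ k' ∈ K.erase k, ((C 1 + ∑ c, C (B k' c) * X (Fin.natAdd h c)) : MvPolynomial (Fin (h + h)) ℂ)) := by
  classical
  induction K using Finset.induction_on generalizing W with
  | empty =>
    rw [Finset.prod_empty, Finset.sum_empty, coeff_one, if_neg]
    intro h0
    have h1 := congrArg (fun v : Fin (h + h) →₀ ℕ => v (Fin.castAdd h a)) h0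
    simp only [Finsupp.coe_zero, Pi.zero_apply,
      ProductStateSums.partitionExpo_apply_castAdd, Finset.mem_singleton, if_true] at h1
    exact absurd h1 (by norm_num)
  | insert k₀ K hk₀ ih =>
    rw [Finset.prod_insert hk₀, mul_comm, coeff_partitionExpo_mul_affine, one_mul, ih W]
    have hx : (∑ a' ∈ ({a} : Finset (Fin h)), A k₀ a' *
        coeff (∑ a'' ∈ ({a} : Finset (Fin h)).erase a', Finsupp.single (Fin.castAdd h a'') 1 +
          ∑ c ∈ W, Finsupp.single (Fin.natAdd h c) 1)
          (∏ k ∈ K, ((C 1 + ∑ a, C (A k a) * X (Fin.castAdd h a) + ∑ c, C (B k c) * X (Fin.natAdd h c)) :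
            MvPolynomial (Fin (h + h)) ℂ))) =
        A k₀ a * coeff (∑ a'' ∈ (∅ : Finset (Fin h)), Finsupp.single (Fin.castAdd h a'') 1 +
          ∑ c ∈ W, Finsupp.single (Fin.natAdd h c) 1)
          (∏ k ∈ K, ((C 1 + ∑ c, C (B k c) * X (Fin.natAdd h c)) : MvPolynomial (Fin (h + h)) ℂ)) := by
      rw [Finset.sum_singleton, Finset.erase_singleton, coeff_empty_prod_forms]
    rw [hx, Finset.sum_insert hk₀, Finset.erase_insert hk₀]
    simp_rw [ih (W.erase _)]
    -- the three pieces: old rows shifted by the new `y`-part, the new `x`-coefficient, the `y`-shifts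
    have hL : ∀ k ∈ K, A k a * coeff (∑ a ∈ (∅ : Finset (Fin h)), Finsupp.single (Fin.castAdd h a) 1 +
          ∑ c ∈ W, Finsupp.single (Fin.natAdd h c) 1)
        (∏ k' ∈ (insert k₀ K).erase k, ((C 1 + ∑ c, C (B k' c) * X (Fin.natAdd h c)) :
          MvPolynomial (Fin (h + h)) ℂ)) =
        A k a * coeff (∑ a ∈ (∅ : Finset (Fin h)), Finsupp.single (Fin.castAdd h a) 1 +
            ∑ c ∈ W, Finsupp.single (Fin.natAdd h c) 1)
          (∏ k' ∈ K.erase k, ((C 1 + ∑ c, C (B k' c) * X (Fin.natAdd h c)) : MvPolynomial (Fin (h + h)) ℂ)) +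
        ∑ c ∈ W, B k₀ c * (A k a * coeff (∑ a ∈ (∅ : Finset (Fin h)), Finsupp.single (Fin.castAdd h a) 1 +
            ∑ c' ∈ W.erase c, Finsupp.single (Fin.natAdd h c') 1)
          (∏ k' ∈ K.erase k, ((C 1 + ∑ c, C (B k' c) * X (Fin.natAdd h c)) : MvPolynomial (Fin (h + h)) ℂ))) := by
      intro k hk
      have hne : k₀ ≠ k := fun e => hk₀ (e ▸ hk)
      rw [Finset.erase_insert_of_ne hne, Finset.prod_insert (fun hm => hk₀ (Finset.mem_of_mem_erase hm)),
        mul_comm (C 1 + ∑ c, C (B k₀ c) * X (Fin.natAdd h c)), coeff_mul_yform, mul_add, Finset.mul_sum]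
      refine congrArg _ (Finset.sum_congr rfl fun c _ => ?_)
      ring
    rw [Finset.sum_congr rfl hL, Finset.sum_add_distrib]
    have hR : ∑ k ∈ K, ∑ c ∈ W, B k₀ c * (A k a *
          coeff (∑ a ∈ (∅ : Finset (Fin h)), Finsupp.single (Fin.castAdd h a) 1 +
            ∑ c' ∈ W.erase c, Finsupp.single (Fin.natAdd h c') 1)
          (∏ k' ∈ K.erase k, ((C 1 + ∑ c, C (B k' c) * X (Fin.natAdd h c)) : MvPolynomial (Fin (h + h)) ℂ))) =
        ∑ c ∈ W, B k₀ c * ∑ k ∈ K, A k a *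
          coeff (∑ a ∈ (∅ : Finset (Fin h)), Finsupp.single (Fin.castAdd h a) 1 +
            ∑ c' ∈ W.erase c, Finsupp.single (Fin.natAdd h c') 1)
          (∏ k' ∈ K.erase k, ((C 1 + ∑ c, C (B k' c) * X (Fin.natAdd h c)) : MvPolynomial (Fin (h + h)) ℂ)) := by
      rw [Finset.sum_comm]
      exact Finset.sum_congr rfl fun c _ => by rw [Finset.mul_sum]
    rw [hR]
    ring

/-! ## 2. The reduction to the leave-out matrix -/

/-- **Item 21850 for a layout, from a nonsingular LEAVE-OUT MATRIX of any `y`-design.**  See the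
module docstring.  (`β i` = the `y`-part of row `i`'s form(s) — one form for a singleton row, the
squared gadget part for a pair row, unused for the empty row; `π p` = public `y`-forms.) -/
theorem chowHitsHH_of_leaveOut (h r : ℕ) (u w : Fin r → Finset (Fin h))
    (hu : Function.Injective u) (hu2 : ∀ i, (u i).card ≤ 2)
    (β : Fin r → Fin h → ℂ) (np : ℕ) (π : Fin np → Fin h → ℂ)
    (hbudget : (Finset.univ.filter fun i : Fin r => (u i).card = 1).card + np +
      2 * (Finset.univ.filter fun i : Fin r => (u i).card = 2).card ≤ h * h)
    (hM : (Matrix.of fun i j : Fin r =>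
        coeff (∑ a ∈ (∅ : Finset (Fin h)), Finsupp.single (Fin.castAdd h a) 1 +
            ∑ c ∈ w j, Finsupp.single (Fin.natAdd h c) 1)
          ((∏ i' ∈ (Finset.univ.filter fun i : Fin r => (u i).card = 1).erase i,
              (C 1 + ∑ c, C (β i' c) * X (Fin.natAdd h c) : MvPolynomial (Fin (h + h)) ℂ)) *
            (∏ p, (C 1 + ∑ c, C (π p c) * X (Fin.natAdd h c) : MvPolynomial (Fin (h + h)) ℂ)) *
            ∏ i' ∈ (Finset.univ.filter fun i : Fin r => (u i).card = 2).erase i,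
              (C 1 + ∑ c, C (β i' c) * X (Fin.natAdd h c) : MvPolynomial (Fin (h + h)) ℂ) ^ 2)).det ≠ 0) :
    ∃ ℓ : Fin (h * h) → MvPolynomial (Fin (h + h)) ℂ, (∀ k, (ℓ k).totalDegree ≤ 1) ∧
      (Matrix.of fun i j : Fin r => MvPolynomial.coeff
        (∑ a ∈ u i, Finsupp.single (Fin.castAdd h a) 1 +
          ∑ c ∈ w j, Finsupp.single (Fin.natAdd h c) 1) (∏ k, ℓ k)).det ≠ 0 := by
  classical
  set Sing : Finset (Fin r) := Finset.univ.filter fun i : Fin r => (u i).card = 1 with hSing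
  set T : Finset (Fin r) := Finset.univ.filter fun i : Fin r => (u i).card = 2 with hT
  have hT2 : ∀ i ∈ T, (u i).card = 2 := fun i hi => (Finset.mem_filter.mp hi).2
  -- `x`-coefficients of the singleton forms: `A (inl i) a = [u i = {a}]`, public forms have none
  set A : Fin r ⊕ Fin np → Fin h → ℂ := fun k a =>
    match k with
    | Sum.inl i => if u i = {a} then 1 else 0
    | Sum.inr _ => 0 with hA
  set B : Fin r ⊕ Fin np → Fin h → ℂ := fun k c =>
    match k with
    | Sum.inl i => β i c
    | Sum.inr p => π p c with hB
  set K : Finset (Fin r ⊕ Fin np) :=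
    Sing.map Function.Embedding.inl ∪ (Finset.univ : Finset (Fin np)).map Function.Embedding.inr with hK
  have hdisj : Disjoint (Sing.map (Function.Embedding.inl : Fin r ↪ Fin r ⊕ Fin np))
      ((Finset.univ : Finset (Fin np)).map Function.Embedding.inr) :=
    Finset.disjoint_left.mpr fun x hx hx' => by
      obtain ⟨i, -, rfl⟩ := Finset.mem_map.mp hx
      obtain ⟨p, -, e⟩ := Finset.mem_map.mp hx'
      exact Sum.inr_ne_inl e
  set F : MvPolynomial (Fin (h + h)) ℂ := ∏ k ∈ K,
    (C 1 + ∑ a, C (A k a) * X (Fin.castAdd h a) + ∑ c, C (B k c) * X (Fin.natAdd h c)) with hF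
  -- packaging of `F` over `Fin m`
  set m : ℕ := K.card with hm
  set e : K ≃ Fin m := K.equivFin with he
  set φ : Fin m → MvPolynomial (Fin (h + h)) ℂ := fun k =>
    C 1 + ∑ a, C (A (e.symm k : Fin r ⊕ Fin np) a) * X (Fin.castAdd h a) +
      ∑ c, C (B (e.symm k : Fin r ⊕ Fin np) c) * X (Fin.natAdd h c) with hφ
  have hφprod : ∏ k, φ k = F := by
    rw [hF, ← Finset.prod_coe_sort K]
    exact Fintype.prod_equiv e.symm _ _ fun k => rfl
  have hφdeg : ∀ k, (φ k).totalDegree ≤ 1 := by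
    intro k
    have e1 : φ k = C 1 + ∑ v : Fin (h + h),
        C (Fin.append (fun a => A (e.symm k : Fin r ⊕ Fin np) a) (fun c => B (e.symm k : Fin r ⊕ Fin np) c) v) *
          X v := by
      rw [hφ, Fin.sum_univ_add]
      simp only [Fin.append_left, Fin.append_right, add_assoc]
    rw [e1]
    exact totalDegree_affine_le _ _
  have hmcard : m = Sing.card + np := by
    rw [hm, hK, Finset.card_union_of_disjoint hdisj, Finset.card_map, Finset.card_map, Finset.card_univ,
      Fintype.card_fin]
  have hbudget' : m + 2 * T.card ≤ h * h := by rw [hmcard]; exact hbudget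
  refine chowHitsHH_of_gadgetCertificate u w hu hu2 T hT2 m φ hφdeg β hbudget' ?_
  simp_rw [hφprod]
  -- the `y`-parts and the leave-out products
  set Yf : Fin r ⊕ Fin np → MvPolynomial (Fin (h + h)) ℂ := fun k =>
    C 1 + ∑ c, C (B k c) * X (Fin.natAdd h c) with hYf
  have hF0 : ∀ (L : Finset (Fin r ⊕ Fin np)) (W' : Finset (Fin h)),
      coeff (∑ a ∈ (∅ : Finset (Fin h)), Finsupp.single (Fin.castAdd h a) 1 +
        ∑ c ∈ W', Finsupp.single (Fin.natAdd h c) 1)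
        (∏ k ∈ L, (C 1 + ∑ a, C (A k a) * X (Fin.castAdd h a) + ∑ c, C (B k c) * X (Fin.natAdd h c))) =
      coeff (∑ a ∈ (∅ : Finset (Fin h)), Finsupp.single (Fin.castAdd h a) 1 +
        ∑ c ∈ W', Finsupp.single (Fin.natAdd h c) 1) (∏ k ∈ L, Yf k) :=
    fun L W' => coeff_empty_prod_forms L A B W'
  -- the product over `K` (or `K.erase (inl i)`) of the `y`-parts is the product in the statement
  have hKprod : ∀ i : Fin r, ∏ k ∈ K.erase (Sum.inl i), Yf k =
      (∏ i' ∈ Sing.erase i, (C 1 + ∑ c, C (β i' c) * X (Fin.natAdd h c) : MvPolynomial (Fin (h + h)) ℂ)) *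
        ∏ p, (C 1 + ∑ c, C (π p c) * X (Fin.natAdd h c) : MvPolynomial (Fin (h + h)) ℂ) := by
    intro i
    have e1 : K.erase (Sum.inl i) = (Sing.erase i).map Function.Embedding.inl ∪
        (Finset.univ : Finset (Fin np)).map Function.Embedding.inr := by
      ext x
      simp only [hK, Finset.mem_erase, Finset.mem_union, Finset.mem_map, Function.Embedding.inl_apply,
        Function.Embedding.inr_apply, Finset.mem_univ, true_and]
      constructor
      · rintro ⟨hne, (⟨i', hi', rfl⟩ | ⟨p, rfl⟩)⟩
        · exact Or.inl ⟨i', ⟨fun e' => hne (by rw [e']), hi'⟩, rfl⟩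
        · exact Or.inr ⟨p, rfl⟩
      · rintro (⟨i', ⟨hne, hi'⟩, rfl⟩ | ⟨p, rfl⟩)
        · exact ⟨fun e' => hne (Sum.inl_injective e'), Or.inl ⟨i', hi', rfl⟩⟩
        · exact ⟨Sum.inr_ne_inl, Or.inr ⟨p, rfl⟩⟩
    have hdisj' : Disjoint ((Sing.erase i).map (Function.Embedding.inl : Fin r ↪ Fin r ⊕ Fin np))
        ((Finset.univ : Finset (Fin np)).map Function.Embedding.inr) :=
      Finset.disjoint_left.mpr fun x hx hx' => by
        obtain ⟨i'', -, rfl⟩ := Finset.mem_map.mp hx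
        obtain ⟨p, -, e'⟩ := Finset.mem_map.mp hx'
        exact Sum.inr_ne_inl e'
    rw [e1, Finset.prod_union hdisj', Finset.prod_map, Finset.prod_map]
    rfl
  have hKprod' : ∏ k ∈ K, Yf k =
      (∏ i' ∈ Sing, (C 1 + ∑ c, C (β i' c) * X (Fin.natAdd h c) : MvPolynomial (Fin (h + h)) ℂ)) *
        ∏ p, (C 1 + ∑ c, C (π p c) * X (Fin.natAdd h c) : MvPolynomial (Fin (h + h)) ℂ) := by
    rw [hK, Finset.prod_union hdisj, Finset.prod_map, Finset.prod_map]
    rfl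
  -- `y`-only facts
  have hYy : ∀ k, ∀ s' ∈ (Yf k).support, ∀ a : Fin h, s' (Fin.castAdd h a) = 0 := by
    intro k
    have e1 : Yf k = C 1 + ∑ a, C ((fun (_ : Fin h) (_ : Finset (Fin h)) => (0 : ℂ)) a ∅) * X (Fin.castAdd h a) +
        ∑ c, C (B k c) * X (Fin.natAdd h c) := (form0_eq (B k) ∅).symm
    rw [e1]
    exact ChowThinAll.yOnly_form0G (fun _ c => B k c) ∅
  have hQy : ∀ (L : Finset (Fin r)), ∀ s' ∈ (∏ i' ∈ L, (C 1 + ∑ c, C (β i' c) * X (Fin.natAdd h c) :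
      MvPolynomial (Fin (h + h)) ℂ) ^ 2).support, ∀ a : Fin h, s' (Fin.castAdd h a) = 0 := by
    intro L
    refine ChowSubcube.yOnly_prod L _ fun i' _ => ?_
    rw [pow_two]
    exact ChowSubcube.yOnly_mul (hYy (Sum.inl i')) (hYy (Sum.inl i'))
  -- entrywise identification with the leave-out matrix
  have hrow : ∀ i j, (if i ∈ T then coeff (∑ a ∈ (∅ : Finset (Fin h)), Finsupp.single (Fin.castAdd h a) 1 +
        ∑ c ∈ w j, Finsupp.single (Fin.natAdd h c) 1) (F * ∏ i' ∈ T.erase i,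
          (C 1 + ∑ c, C (β i' c) * X (Fin.natAdd h c)) ^ 2)
      else coeff (∑ a ∈ u i, Finsupp.single (Fin.castAdd h a) 1 +
        ∑ c ∈ w j, Finsupp.single (Fin.natAdd h c) 1) (F * ∏ i' ∈ T,
          (C 1 + ∑ c, C (β i' c) * X (Fin.natAdd h c)) ^ 2)) =
      coeff (∑ a ∈ (∅ : Finset (Fin h)), Finsupp.single (Fin.castAdd h a) 1 +
          ∑ c ∈ w j, Finsupp.single (Fin.natAdd h c) 1)
        ((∏ i' ∈ Sing.erase i, (C 1 + ∑ c, C (β i' c) * X (Fin.natAdd h c) : MvPolynomial (Fin (h + h)) ℂ)) *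
          (∏ p, (C 1 + ∑ c, C (π p c) * X (Fin.natAdd h c) : MvPolynomial (Fin (h + h)) ℂ)) *
          ∏ i' ∈ T.erase i, (C 1 + ∑ c, C (β i' c) * X (Fin.natAdd h c) : MvPolynomial (Fin (h + h)) ℂ) ^ 2) := by
    intro i j
    by_cases hiT : i ∈ T
    · -- gadget row: `i ∉ Sing`, only the `∅`-coefficients of `F` matter
      rw [if_pos hiT]
      have hiS : i ∉ Sing := fun hi => by
        have h1 := (Finset.mem_filter.mp hi).2; have h2 := hT2 i hiT; omega
      rw [Finset.erase_eq_of_notMem hiS, ← hKprod', coeff_partitionExpo_mul_yOnly F _ (hQy _) ∅ (w j),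
        coeff_partitionExpo_mul_yOnly (∏ k ∈ K, Yf k) _ (hQy _) ∅ (w j)]
      exact Finset.sum_congr rfl fun d _ => by rw [hF, hF0]
    · rw [if_neg hiT]
      have hn2 : (u i).card ≠ 2 := fun e' => hiT (Finset.mem_filter.mpr ⟨Finset.mem_univ _, e'⟩)
      have hui2 := hu2 i
      rw [Finset.erase_eq_of_notMem hiT]
      rcases Nat.lt_or_ge (u i).card 1 with h0 | h1
      · -- empty row
        have hui : u i = ∅ := Finset.card_eq_zero.mp (by omega)
        have hiS : i ∉ Sing := fun hi => by have := (Finset.mem_filter.mp hi).2; omega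
        rw [hui, Finset.erase_eq_of_notMem hiS, ← hKprod',
          coeff_partitionExpo_mul_yOnly F _ (hQy _) ∅ (w j),
          coeff_partitionExpo_mul_yOnly (∏ k ∈ K, Yf k) _ (hQy _) ∅ (w j)]
        exact Finset.sum_congr rfl fun d _ => by rw [hF, hF0]
      · -- singleton row
        have hc1 : (u i).card = 1 := by omega
        obtain ⟨a, ha⟩ := Finset.card_eq_one.mp hc1
        have hiS : i ∈ Sing := Finset.mem_filter.mpr ⟨Finset.mem_univ _, hc1⟩
        rw [coeff_partitionExpo_mul_yOnly F _ (hQy _) (u i) (w j), ← hKprod i,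
          coeff_partitionExpo_mul_yOnly (∏ k ∈ K.erase (Sum.inl i), Yf k) _ (hQy _) ∅ (w j)]
        refine Finset.sum_congr rfl fun d _ => ?_
        rw [ha, hF, coeff_single_prod_forms K A B a (w j \ d)]
        -- only the form of row `i` carries `x_a`
        have hAk : ∀ k ∈ K, A k a * coeff (∑ a' ∈ (∅ : Finset (Fin h)), Finsupp.single (Fin.castAdd h a') 1 +
              ∑ c ∈ w j \ d, Finsupp.single (Fin.natAdd h c) 1) (∏ k' ∈ K.erase k, Yf k') =
            if k = Sum.inl i then coeff (∑ a' ∈ (∅ : Finset (Fin h)), Finsupp.single (Fin.castAdd h a') 1 +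
              ∑ c ∈ w j \ d, Finsupp.single (Fin.natAdd h c) 1) (∏ k' ∈ K.erase (Sum.inl i), Yf k') else 0 := by
          intro k hk
          rcases k with i' | p
          · by_cases hii : i' = i
            · subst hii
              simp only [hA, ha, if_true, one_mul]
            · have hne : u i' ≠ {a} := fun e' => hii (hu (e'.trans ha.symm))
              simp only [hA, if_neg hne, zero_mul]
              rw [if_neg (fun e' => hii (Sum.inl_injective e'))]
          · simp only [hA, zero_mul]
            rw [if_neg Sum.inr_ne_inl]
        rw [Finset.sum_congr rfl hAk, Finset.sum_ite_eq', if_pos]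
        exact Finset.mem_union_left _ (Finset.mem_map_of_mem _ hiS)
  have hmat : (Matrix.of fun i j : Fin r =>
      if i ∈ T then coeff (∑ a ∈ (∅ : Finset (Fin h)), Finsupp.single (Fin.castAdd h a) 1 +
          ∑ c ∈ w j, Finsupp.single (Fin.natAdd h c) 1)
          ((∏ k, φ k) * ∏ i' ∈ T.erase i, (C 1 + ∑ c, C (β i' c) * X (Fin.natAdd h c)) ^ 2)
      else coeff (∑ a ∈ u i, Finsupp.single (Fin.castAdd h a) 1 +
          ∑ c ∈ w j, Finsupp.single (Fin.natAdd h c) 1)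
          ((∏ k, φ k) * ∏ i' ∈ T, (C 1 + ∑ c, C (β i' c) * X (Fin.natAdd h c)) ^ 2)) =
      Matrix.of fun i j : Fin r =>
        coeff (∑ a ∈ (∅ : Finset (Fin h)), Finsupp.single (Fin.castAdd h a) 1 +
            ∑ c ∈ w j, Finsupp.single (Fin.natAdd h c) 1)
          ((∏ i' ∈ Sing.erase i, (C 1 + ∑ c, C (β i' c) * X (Fin.natAdd h c) : MvPolynomial (Fin (h + h)) ℂ)) *
            (∏ p, (C 1 + ∑ c, C (π p c) * X (Fin.natAdd h c) : MvPolynomial (Fin (h + h)) ℂ)) *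
            ∏ i' ∈ T.erase i, (C 1 + ∑ c, C (β i' c) * X (Fin.natAdd h c) : MvPolynomial (Fin (h + h)) ℂ) ^ 2) := by
    ext i j
    rw [Matrix.of_apply, Matrix.of_apply, hφprod]
    exact hrow i j
  rw [hφprod] at hmat
  rw [hmat]
  exact hM

end Summit.ValiantsHypothesis.ValiantsHypothesis.Theorems.BarrierLever.ChowThinHH
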